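import Summits.ResolutionOfSingularities.ResolutionOfSingularities.Theorems.MarkedTransferCampaignW46FiniteExitBoundNodes
import Literature.AlgebraicGeometry.Resolution.IdealBaseTreeCount
import Literature.AlgebraicGeometry.Resolution.IdealBaseTreeTransport
import Literature.AlgebraicGeometry.Resolution.BaseTreeFiniteKonig
import Literature.AlgebraicGeometry.Resolution.NonPrincipalLocus
import Literature.AlgebraicGeometry.Resolution.EmbeddedCurvePointBlowups
import Literature.AlgebraicGeometry.Resolution.PermissibleCentres
import Summits.ResolutionOfSingularities.ResolutionOfSingularities.Theorems.EquisingularLiftEquisingularLiftNatJumpBlowupNotNormal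
import HarnessLib

/-!
# [F-75c discharge, brick P2] One point blow-up lowers Zariski's base-point count of an ideal sheaf
# (The Stacks Project, Lemma 54.4.1 = Tag 0AHH — termination of the principalization by point blow-ups)

Cell res-hironaka, D-0154 INPUTS discharger `res-inputs-p-f75c` for the named fact F-75c
`Literature.AlgebraicGeometry.Resolution.Stacks0BIC_embeddedResolutionCurvesInSurfaces_locus`
(`--supports stmt-ResolutionOfSingularities-15917`, consumers `stub_stacks0BICLocus`,
`cleanModels_dimTwo_of_f75c`). HONEST FRAMING: scheme bookkeeping over the tree's scheme ↔ local-ring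
dictionary of campaign W46 (`…W46FiniteExitBoundQuadratic/Transform/Nodes`) and Zariski's finiteness of the
base tree of an ideal (`BaseTreeFiniteKonig.lean`, `IdealBaseTreeCount.lean`, `IdealBaseTreeTransport.lean`).
Nothing here is a statement of [Hironaka2017]. AI-written; AI review is weaker than expert review.

## The measure

For an integral locally Noetherian scheme `X`, an ideal sheaf `I` and a point `y`, read the local ring
in the function field, `R_y := (𝒪_{X,y} → K(X)).range`, and the germ `J_y := I_y R_y`; the LOCAL COUNT at
`y` is `#idealBaseTree R_y J_y`, the number of iterated quadratic transforms of `R_y` in which `I_y` does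
not become principal (finite when `𝒪_{X,y}` is regular of dimension `2`, Zariski–Samuel II App. 5). The
MEASURE of `(X, I)` is the sum of the local counts over the (finite) non-locally-principal locus of `I`.

## What is proved

For the blowing up `π : X' → X` of `X` (integral, locally Noetherian, regular with two-dimensional stalks
at the non-principal points) in a closed point `x` at which `I` is not locally principal:

* `ncard_idealBaseTree_eq_of_stalkEmb` — the local count of `I·𝒪_{X'}` at `x'`, read in `K(X')`, equals
  the count of `(ε_{x'}(𝒪_{X',x'}), I·ε)` read in `K(X)` (transport along `ε_{η'} : K(X') ≅ K(X)`);
* `sum_fibre_ncard_add_one_le` — over the points of the fibre `π⁻¹(x)` the local counts of `I·𝒪_{X'}` sum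
  to at most `#idealBaseTree R_x J_x − 1` (their local rings are DISTINCT quadratic transforms of `R_x`);
* `ncard_idealBaseTree_eq_of_ne` — off the fibre the local count is unchanged;
* **`measure_comap_lt`** — the measure of `(X', I·𝒪_{X'})` is smaller than that of `(X, I)`.

References: The Stacks Project, Tags 0AHH, 0BIB [StacksProject]; Zariski–Samuel II (1960), App. 5 [ZariskiSamuel1960].
-/

noncomputable section

set_option linter.dupNamespace false -- mandated namespace of this single-conjunct summit

open CategoryTheory AlgebraicGeometry TopologicalSpace IsLocalRing

namespace Summit.ResolutionOfSingularities.ResolutionOfSingularities.Theorems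

namespace F75c

open Literature.AlgebraicGeometry.Resolution
open Summit.ResolutionOfSingularities.ResolutionOfSingularities.Theorems.CampaignW46
open Scheme.IdealSheafData

universe u

/-! ## Generic algebra -/

/-- Principality is invariant under reading an ideal through an injective ring homomorphism onto its
range. [folklore] -/
theorem isPrincipal_map_rangeRestrict_iff {A B : Type*} [CommRing A] [CommRing B] (f : A →+* B)
    (hf : Function.Injective f) (𝔞 : Ideal A) :
    (𝔞.map f.rangeRestrict).IsPrincipal ↔ 𝔞.IsPrincipal := by
  set e : A ≃+* f.range := RingEquiv.ofBijective f.rangeRestrict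
    ⟨fun _ _ h => hf (congrArg Subtype.val h), f.rangeRestrict_surjective⟩ with he
  change (𝔞.map e.toRingHom).IsPrincipal ↔ _
  constructor
  · intro h
    have h2 := h.map_ringHom e.symm.toRingHom
    rw [Ideal.map_map] at h2
    have hid : e.symm.toRingHom.comp e.toRingHom = RingHom.id A := RingHom.ext fun a => e.symm_apply_apply a
    rwa [hid, Ideal.map_id] at h2
  · intro h
    exact h.map_ringHom e.toRingHom

/-! ## The local rings and germs read in the function field -/

section Reading

variable {X : Scheme.{u}} [IsIntegral X]

/-- The image in `K(X)` of the germ ideal read in `R_y`: `coe '' (I_y R_y) = (𝒪_{X,y} → K(X)) '' I_y`.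
[folklore] -/
theorem coe_image_map_rangeRestrict {A : Type u} [CommRing A] {L : Type u} [Field L] (f : A →+* L)
    (𝔞 : Ideal A) :
    ((↑) : f.range → L) '' ((𝔞.map f.rangeRestrict : Ideal f.range) : Set f.range) = f '' (𝔞 : Set A) := by
  have hsurj : Function.Surjective f.rangeRestrict := f.rangeRestrict_surjective
  ext l
  constructor
  · rintro ⟨z, hz, rfl⟩
    rw [SetLike.mem_coe, Ideal.mem_map_iff_of_surjective _ hsurj] at hz
    obtain ⟨a, ha, rfl⟩ := hz
    exact ⟨a, ha, rfl⟩
  · rintro ⟨a, ha, rfl⟩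
    exact ⟨f.rangeRestrict a, Ideal.mem_map_of_mem _ ha, rfl⟩

/-- `I_y` is principal iff its reading `J_y = I_y R_y` in `R_y ⊆ K(X)` is. [folklore] -/
theorem isPrincipal_stalkIdeal_iff (I : X.IdealSheafData) (y : X) :
    ((stalkIdeal I y).map (algebraMap (X.presheaf.stalk y) X.functionField).rangeRestrict).IsPrincipal ↔
      (stalkIdeal I y).IsPrincipal :=
  isPrincipal_map_rangeRestrict_iff _ (algebraMap_stalk_functionField_injective y) _

end Reading

/-! ## One blow-up: the rings over the centre and off the centre -/

section Step

variable {X X' : Scheme.{u}} [IsIntegral X] [IsLocallyNoetherian X] {π : X' ⟶ X}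
  {C : X.IdealSheafData}

/-- **The germ of `I·𝒪_{X'}` at `x'`, read through `ε_{x'}`, is the extension of `J_{π x'}` to
`ε_{x'}(𝒪_{X',x'})`.** [cite: StacksProject, Tag 0804] -/
theorem map_rangeRestrict_stalkEmb_stalkIdeal_comap (hπ : IsBlowup π C) (I : X.IdealSheafData) (x' : X') :
    haveI := isLocalRing_range_algebraMap_stalk (Z := X) (π x')
    (stalkIdeal (I.comap π) x').map (hπ.stalkEmb x').rangeRestrict =
      extIdeal ((stalkIdeal I (π x')).map
        (algebraMap (X.presheaf.stalk (π x')) X.functionField).rangeRestrict) (hπ.stalkEmb x').range := by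
  have hle : (algebraMap (X.presheaf.stalk (π x')) X.functionField).range ≤ (hπ.stalkEmb x').range := by
    rintro _ ⟨b, rfl⟩
    exact ⟨(π.stalkMap x').hom b, hπ.stalkEmb_stalkMap x' b⟩
  rw [extIdeal_eq_map _ hle, Ideal.map_map, stalkIdeal_comap_eq_map_stalkMap, Ideal.map_map]
  congr 1
  ext a
  change hπ.stalkEmb x' ((π.stalkMap x').hom a) = algebraMap (X.presheaf.stalk (π x')) X.functionField a
  exact hπ.stalkEmb_stalkMap x' a

/-- **Off the centre the reading does not change**: if `π x' ∉ V(C)` then `ε_{x'}(𝒪_{X',x'}) = R_{π x'}`.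
[cite: GortzWedhorn2020, Prop. 13.91 (3)] -/
theorem range_stalkEmb_eq_of_not_mem (hπ : IsBlowup π C) {x' : X'} (hx' : π x' ∉ C.support) :
    (hπ.stalkEmb x').range = (algebraMap (X.presheaf.stalk (π x')) X.functionField).range := by
  haveI := hπ.isIso_stalkMap_of_not_mem_support hx'
  have hsurj : Function.Surjective (π.stalkMap x').hom :=
    (ConcreteCategory.bijective_of_isIso (π.stalkMap x')).2
  ext z
  constructor
  · rintro ⟨a, rfl⟩
    obtain ⟨b, rfl⟩ := hsurj a
    exact ⟨b, (hπ.stalkEmb_stalkMap x' b).symm⟩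
  · rintro ⟨b, rfl⟩
    exact ⟨(π.stalkMap x').hom b, hπ.stalkEmb_stalkMap x' b⟩

/-- **Off the centre the local count does not change.** [cite: ZariskiSamuel1960, Appendix 5] -/
theorem ncard_idealBaseTree_stalkEmb_eq_of_not_mem (hπ : IsBlowup π C) (I : X.IdealSheafData) {x' : X'}
    (hx' : π x' ∉ C.support) :
    (idealBaseTree (hπ.stalkEmb x').range
        ((stalkIdeal (I.comap π) x').map (hπ.stalkEmb x').rangeRestrict)).ncard =
      (idealBaseTree (algebraMap (X.presheaf.stalk (π x')) X.functionField).range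
        ((stalkIdeal I (π x')).map
          (algebraMap (X.presheaf.stalk (π x')) X.functionField).rangeRestrict)).ncard := by
  rw [map_rangeRestrict_stalkEmb_stalkIdeal_comap hπ I x']
  have key : ∀ (S : Subring X.functionField)
      (hS : S = (algebraMap (X.presheaf.stalk (π x')) X.functionField).range),
      idealBaseTree S (extIdeal ((stalkIdeal I (π x')).map
        (algebraMap (X.presheaf.stalk (π x')) X.functionField).rangeRestrict) S) =
      idealBaseTree (algebraMap (X.presheaf.stalk (π x')) X.functionField).range
        ((stalkIdeal I (π x')).map
          (algebraMap (X.presheaf.stalk (π x')) X.functionField).rangeRestrict) := by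
    rintro S rfl
    rw [extIdeal_self]
  rw [key _ (range_stalkEmb_eq_of_not_mem hπ hx')]

end Step

/-! ## Reading in `K(X')` versus reading through `ε` in `K(X)` -/

section Transport

variable {X X' : Scheme.{u}} [IsIntegral X] [IsLocallyNoetherian X] {π : X' ⟶ X}
  {C : X.IdealSheafData} [IsIntegral X']

/-- `ε_{x'} = ε_{η'} ∘ (𝒪_{X',x'} → K(X'))` (compatibility of the canonical embeddings with
specialization from the generic point). [cite: Kollar2007, §1.4] -/
theorem stalkEmb_eq_comp_algebraMap (hπ : IsBlowup π C) (x' : X') :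
    hπ.stalkEmb x' =
      (hπ.stalkEmb (genericPoint X')).comp (algebraMap (X'.presheaf.stalk x') X'.functionField) := by
  rw [RingHom.algebraMap_toAlgebra]
  exact (hπ.stalkEmb_comp_stalkSpecializes ((genericPoint_spec X').specializes trivial)).symm

/-- `ε_{η'} : K(X') → K(X)` is bijective (the blowing up is birational). [cite: StacksProject, Tag 02OS] -/
theorem stalkEmb_genericPoint_bijective (hπ : IsBlowup π C) :
    Function.Bijective (hπ.stalkEmb (genericPoint X')) := by
  refine ⟨hπ.stalkEmb_injective _, fun z => ?_⟩
  obtain ⟨a, c, -, rfl⟩ := exists_frac_stalkEmb hπ (genericPoint X') z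
  exact ⟨a / c, by rw [map_div₀]⟩

/-- `ε_{x'}(𝒪_{X',x'}) = ε_{η'}((𝒪_{X',x'} → K(X')).range)`. [cite: Kollar2007, §1.4] -/
theorem range_stalkEmb_eq_map (hπ : IsBlowup π C) (x' : X') :
    (hπ.stalkEmb x').range =
      ((algebraMap (X'.presheaf.stalk x') X'.functionField).range).map
        (RingEquiv.ofBijective (hπ.stalkEmb (genericPoint X'))
          (stalkEmb_genericPoint_bijective hπ)).toRingHom := by
  have h : (RingEquiv.ofBijective (hπ.stalkEmb (genericPoint X'))
      (stalkEmb_genericPoint_bijective hπ)).toRingHom = hπ.stalkEmb (genericPoint X') :=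
    RingHom.ext fun _ => rfl
  rw [h, RingHom.map_range, ← stalkEmb_eq_comp_algebraMap hπ x']

/-- **The local count of an ideal sheaf `I'` on `X'` at `x'`, read in `K(X')`, equals the count of its
reading through `ε_{x'}` in `K(X)`** (transport along `ε_{η'} : K(X') ≅ K(X)`).
[cite: ZariskiSamuel1960, Appendix 5] -/
theorem ncard_idealBaseTree_eq_of_stalkEmb (hπ : IsBlowup π C) (I' : X'.IdealSheafData) (x' : X') :
    (idealBaseTree (algebraMap (X'.presheaf.stalk x') X'.functionField).range
        ((stalkIdeal I' x').map (algebraMap (X'.presheaf.stalk x') X'.functionField).rangeRestrict)).ncard =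
      (idealBaseTree (hπ.stalkEmb x').range
        ((stalkIdeal I' x').map (hπ.stalkEmb x').rangeRestrict)).ncard := by
  set φ := RingEquiv.ofBijective (hπ.stalkEmb (genericPoint X')) (stalkEmb_genericPoint_bijective hπ)
    with hφ
  have hφε : ∀ a : X'.presheaf.stalk x',
      φ (algebraMap (X'.presheaf.stalk x') X'.functionField a) = hπ.stalkEmb x' a := by
    intro a
    change hπ.stalkEmb (genericPoint X') _ = _
    rw [stalkEmb_eq_comp_algebraMap hπ x']
    rfl
  -- generalize the subring `ε_{x'}(𝒪_{X',x'})` to `R.map φ`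
  suffices key : ∀ (S : Subring X.functionField) (JS : Ideal S)
      (hS : S = ((algebraMap (X'.presheaf.stalk x') X'.functionField).range).map φ.toRingHom)
      (hJS : ((↑) : S → X.functionField) '' (JS : Set S) =
        hπ.stalkEmb x' '' (stalkIdeal I' x' : Set (X'.presheaf.stalk x'))),
      (idealBaseTree (algebraMap (X'.presheaf.stalk x') X'.functionField).range
        ((stalkIdeal I' x').map (algebraMap (X'.presheaf.stalk x') X'.functionField).rangeRestrict)).ncard =
      (idealBaseTree S JS).ncard by
    exact key _ _ (range_stalkEmb_eq_map hπ x') (coe_image_map_rangeRestrict _ _)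
  rintro S JS rfl hJS
  symm
  refine ncard_idealBaseTree_map_equiv φ ?_
  rw [hJS, coe_image_map_rangeRestrict, Set.image_image]
  ext z
  constructor
  · rintro ⟨a, ha, rfl⟩
    exact ⟨a, ha, hφε a⟩
  · rintro ⟨a, ha, rfl⟩
    exact ⟨a, ha, (hφε a).symm⟩

end Transport

/-! ## The count over the fibre of the blown-up point -/

section Fibre

variable {X X' : Scheme.{u}} [IsIntegral X] [IsLocallyNoetherian X] {π : X' ⟶ X} [IsIntegral X']

omit [IsIntegral X'] in
/-- Summand bookkeeping: at a point `x'` over `x` the reading of `(I·𝒪_{X'})_{x'}` through `ε_{x'}` is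
`J_x ε_{x'}(𝒪_{X',x'})`. [cite: StacksProject, Tag 0804] -/
theorem ncard_idealBaseTree_stalkEmb_eq_extIdeal {C : X.IdealSheafData} (hπ : IsBlowup π C)
    (I : X.IdealSheafData) {x : X} {x' : X'} (h : π x' = x) :
    haveI := isLocalRing_range_algebraMap_stalk (Z := X) x
    (idealBaseTree (hπ.stalkEmb x').range
        ((stalkIdeal (I.comap π) x').map (hπ.stalkEmb x').rangeRestrict)).ncard =
      (idealBaseTree (hπ.stalkEmb x').range
        (extIdeal ((stalkIdeal I x).map
          (algebraMap (X.presheaf.stalk x) X.functionField).rangeRestrict) (hπ.stalkEmb x').range)).ncard := by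
  subst h
  rw [map_rangeRestrict_stalkEmb_stalkIdeal_comap hπ I x']

/-- **Over the blown-up point the local counts of `I·𝒪_{X'}` add up to less than the local count of
`I` at `x`**: the local rings `ε_{x'}(𝒪_{X',x'})`, `π x' = x`, are pairwise distinct quadratic
transforms of `R_x` (W46 dictionary), their base trees for `J_x` are disjoint subsets of the base tree
of `R_x` off the root (Zariski's count). Hypotheses: `𝒪_{X,x}` regular of dimension `2`, `I_x` not
principal. [cite: ZariskiSamuel1960, Appendix 5] [cite: StacksProject, Tag 0AHH] -/
theorem sum_fibre_ncard_add_one_le {x : X} (hx : IsClosed ({x} : Set X))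
    (hπ : IsBlowup π (vanishingIdeal ⟨{x}, hx⟩)) [IsRegularLocalRing (X.presheaf.stalk x)]
    (h2 : ringKrullDim (X.presheaf.stalk x) = 2) (I : X.IdealSheafData)
    (hxI : ¬ (stalkIdeal I x).IsPrincipal) (F : Finset X') (hF : ∀ x' ∈ F, π x' = x) :
    ∑ x' ∈ F, (idealBaseTree (hπ.stalkEmb x').range
        ((stalkIdeal (I.comap π) x').map (hπ.stalkEmb x').rangeRestrict)).ncard + 1 ≤
      (idealBaseTree (algebraMap (X.presheaf.stalk x) X.functionField).range
        ((stalkIdeal I x).map (algebraMap (X.presheaf.stalk x) X.functionField).rangeRestrict)).ncard := by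
  classical
  haveI := isLocalRing_range_algebraMap_stalk (Z := X) x
  set R : Subring X.functionField := (algebraMap (X.presheaf.stalk x) X.functionField).range with hR
  set J : Ideal R := (stalkIdeal I x).map
    (algebraMap (X.presheaf.stalk x) X.functionField).rangeRestrict with hJ
  -- the summands as functions of the subring `ε_{x'}(𝒪_{X',x'})`
  let g : Subring X.functionField → ℕ := fun S => (idealBaseTree S (extIdeal J S)).ncard
  have hsum : ∑ x' ∈ F, (idealBaseTree (hπ.stalkEmb x').range
      ((stalkIdeal (I.comap π) x').map (hπ.stalkEmb x').rangeRestrict)).ncard =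
      ∑ x' ∈ F, g (hπ.stalkEmb x').range :=
    Finset.sum_congr rfl fun x' hx' => ncard_idealBaseTree_stalkEmb_eq_extIdeal hπ I (hF x' hx')
  -- distinct points over `x` have distinct local rings in `K(X)`
  have hinj : Set.InjOn (fun x' : X' => (hπ.stalkEmb x').range) (F : Set X') := by
    intro x₁ h₁ x₂ h₂ h12
    exact eq_of_range_stalkEmb_eq hπ ((hF x₁ h₁).trans (hF x₂ h₂).symm) h12
  rw [hsum, ← Finset.sum_image hinj]
  -- Zariski's count
  haveI : IsRegularLocalRing R := isRegularLocalRing_range_of x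
  have hR2 : ringKrullDim R = 2 := by rw [hR, ringKrullDim_range_algebraMap_stalk]; exact h2
  have hfg : (maximalIdeal R).FG := IsNoetherian.noetherian _
  have hm : ∀ z : R, maximalIdeal R ≠ Ideal.span {z} :=
    EquisingularLift.RamifiedCoalescence.maximalIdeal_ne_span_singleton_of_dim_two hR2
  have hJfg : J.FG := IsNoetherian.noetherian _
  have hJ' : ¬ J.IsPrincipal := fun h => hxI ((isPrincipal_stalkIdeal_iff I x).mp h)
  have hJ0 : J ≠ ⊥ := fun h => hJ' (by rw [h]; exact ⟨⟨0, by simp⟩⟩)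
  have hfin : (idealBaseTree R J).Finite :=
    finite_idealBaseTree_of_isRegularLocalRing R hR2 (isLocalRingOf_range_algebraMap_stalk x) J
  refine sum_ncard_idealBaseTree_add_one_le hfg hm hJfg hJ0 hJ' hfin _ fun S hS => ?_
  obtain ⟨x', hx', rfl⟩ := Finset.mem_image.mp hS
  exact isQuadraticTransform_range_stalkEmb' hπ (hF x' hx') (stalkIdeal_vanishingIdeal_singleton hx)

end Fibre

/-! ## The measure drops -/

section Measure

variable {X X' : Scheme.{u}} [IsIntegral X] [IsLocallyNoetherian X] {π : X' ⟶ X} [IsIntegral X']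

/-- **One blow-up at a non-principal point lowers the measure** (termination of Stacks Lemma 54.4.1 =
Tag 0AHH, via Zariski–Samuel App. 5): for `π : X' → X` the blowing up of the integral locally
Noetherian `X` in a closed point `x` with `𝒪_{X,x}` regular of dimension `2` and `I_x` not principal,
and finite non-principal loci, the sum of the local counts of `I·𝒪_{X'}` over its non-principal locus is
smaller than that of `I`. [cite: StacksProject, Tag 0AHH] [cite: ZariskiSamuel1960, Appendix 5] -/
theorem measure_comap_lt {x : X} (hx : IsClosed ({x} : Set X))
    (hπ : IsBlowup π (vanishingIdeal ⟨{x}, hx⟩)) [IsRegularLocalRing (X.presheaf.stalk x)]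
    (h2 : ringKrullDim (X.presheaf.stalk x) = 2) (I : X.IdealSheafData)
    (hxI : x ∈ nonPrincipalLocus I)
    (hN : (nonPrincipalLocus I : Set X).Finite) (hN' : (nonPrincipalLocus (I.comap π) : Set X').Finite) :
    ∑ x' ∈ hN'.toFinset, (idealBaseTree (algebraMap (X'.presheaf.stalk x') X'.functionField).range
        ((stalkIdeal (I.comap π) x').map
          (algebraMap (X'.presheaf.stalk x') X'.functionField).rangeRestrict)).ncard <
      ∑ y ∈ hN.toFinset, (idealBaseTree (algebraMap (X.presheaf.stalk y) X.functionField).range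
        ((stalkIdeal I y).map (algebraMap (X.presheaf.stalk y) X.functionField).rangeRestrict)).ncard := by
  classical
  haveI : IsLocallyNoetherian X' := by
    haveI : IsProper π := hπ.isProper
    exact LocallyOfFiniteType.isLocallyNoetherian π
  -- the local count on `X` as a function of the point
  let f : X → ℕ := fun y => (idealBaseTree (algebraMap (X.presheaf.stalk y) X.functionField).range
    ((stalkIdeal I y).map (algebraMap (X.presheaf.stalk y) X.functionField).rangeRestrict)).ncard
  -- the local count on `X'` read through `ε`
  let T : X' → ℕ := fun x' => (idealBaseTree (hπ.stalkEmb x').range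
    ((stalkIdeal (I.comap π) x').map (hπ.stalkEmb x').rangeRestrict)).ncard
  have hT : ∑ x' ∈ hN'.toFinset, (idealBaseTree (algebraMap (X'.presheaf.stalk x') X'.functionField).range
      ((stalkIdeal (I.comap π) x').map
        (algebraMap (X'.presheaf.stalk x') X'.functionField).rangeRestrict)).ncard =
      ∑ x' ∈ hN'.toFinset, T x' :=
    Finset.sum_congr rfl fun x' _ => ncard_idealBaseTree_eq_of_stalkEmb hπ (I.comap π) x'
  rw [hT]
  change ∑ x' ∈ hN'.toFinset, T x' < ∑ y ∈ hN.toFinset, f y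
  -- split the non-principal locus of `I·𝒪_{X'}` into the fibre of `x` and the rest
  rw [← Finset.sum_filter_add_sum_filter_not hN'.toFinset (fun x' => π x' = x)]
  -- the fibre part
  have hxI' : ¬ (stalkIdeal I x).IsPrincipal := by
    have h := hxI
    rw [← SetLike.mem_coe, coe_nonPrincipalLocus_eq_setOf_not_isPrincipal] at h
    exact h
  have hA : ∑ x' ∈ hN'.toFinset.filter (fun x' => π x' = x), T x' + 1 ≤ f x :=
    sum_fibre_ncard_add_one_le hx hπ h2 I hxI' _ fun x' hx' => (Finset.mem_filter.mp hx').2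
  -- the rest: unchanged counts at the (unique) preimages of the other non-principal points
  have hsupp : ((vanishingIdeal (⟨{x}, hx⟩ : Closeds X)).support : Set X) = {x} :=
    coe_support_vanishingIdeal _
  have hB : ∑ x' ∈ hN'.toFinset.filter (fun x' => ¬ π x' = x), T x' ≤ ∑ y ∈ hN.toFinset.erase x, f y := by
    have hTf : ∀ x' ∈ hN'.toFinset.filter (fun x' => ¬ π x' = x), T x' = f (π x') := by
      intro x' hx'
      have hne : π x' ≠ x := (Finset.mem_filter.mp hx').2
      exact ncard_idealBaseTree_stalkEmb_eq_of_not_mem hπ I (by rw [← SetLike.mem_coe, hsupp]; exact hne)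
    rw [Finset.sum_congr rfl hTf]
    have hinj : Set.InjOn (fun x' : X' => π x') (hN'.toFinset.filter (fun x' => ¬ π x' = x) : Set X') := by
      intro x₁ h₁ x₂ h₂ h12
      have hne : π x₂ ≠ x := (Finset.mem_filter.mp h₂).2
      obtain ⟨y', -, huniq⟩ := hπ.existsUnique_preimage_of_ne hsupp hne
      exact (huniq x₁ h12).trans (huniq x₂ rfl).symm
    rw [← Finset.sum_image hinj]
    refine Finset.sum_le_sum_of_subset_of_nonneg (fun y hy => ?_) fun _ _ _ => Nat.zero_le _
    obtain ⟨x', hx', rfl⟩ := Finset.mem_image.mp hy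
    obtain ⟨hx'N, hne⟩ := Finset.mem_filter.mp hx'
    refine Finset.mem_erase.mpr ⟨hne, ?_⟩
    rw [Set.Finite.mem_toFinset]
    exact nonPrincipalLocus_comap_subset π I ((Set.Finite.mem_toFinset _).mp hx'N)
  -- assemble
  have hxN : x ∈ hN.toFinset := by rw [Set.Finite.mem_toFinset]; exact hxI
  rw [← Finset.add_sum_erase _ f hxN]
  omega

end Measure

end F75c

end Summit.ResolutionOfSingularities.ResolutionOfSingularities.Theorems

end
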